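import Summits.CriticalPhenomena.PercolationContinuityZ3.Theorems.PercNearOneGluingNoHeavyLowerTailSahiGridPatternSliceForm
import Summits.CriticalPhenomena.PercolationContinuityZ3.Theorems.PercNearOneGluingNoHeavyLowerTailSahiGridPatternZProfile

/-!
# `NoHeavyLowerTail` (crux stmt-CriticalPhenomena-4575), Sahi programme P1: the z-DECOMPOSITION of the pattern functional and
# **THE z-PROFILE IS NONNEGATIVE ON `C`** — every dimension

Support file (Sahi cell, seat `prim-sahi-p1`, generation 8; `--supports stmt-CriticalPhenomena-4575`).  Pure proofs; definitions are
bookkeeping (`zProfile`, the Boolean-cube chart `hiVal/loVal/fromSet`, the set family `fam`, and the obligation `ZProfileDual d`); no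
`sorry`, standard axioms.

THE MATHEMATICS.  `sStarD A B C = Σ_{π ∈ S₃^d} h(P^π_0,P^π_1,P^π_2)` (`…SahiGridPattern`).  Grouping the permutation patterns by their
THIRD point `u = P^π_2`: the first point `x = P^π_0` ranges over the `2^d` points differing from `u` in every axis and the second is forced,
`P^π_1 = thirdPt x u`.  So
* `sStarD_eq_sum_zProfile`: `sStarD A B C = Σ_u zProfile A B C u`, `zProfile A B C u := Σ_{x δ̸ u} h(x, x̄, u)` (`x̄ = thirdPt x u`).
* The points `x δ̸ u` form a Boolean cube `Q_u ≅ 2^[d]` (chart `fromSet u : Finset (Fin d) → Q_u`, axis `a` taking the larger / smaller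
  of the two values `≠ u_a` according as `a ∈ T`), `x̄` is the complement, and an up-set `A` of `[3]^d` traces an UPPER family `fam u A`
  on it; `zProfile_eq_card`: `zProfile A B C u = 2·#(𝒜∩ℬ∩𝒞) − #(𝒜∩(ℬ∩𝒞)ᶜˢ) − #(ℬ∩(𝒜∩𝒞)ᶜˢ) − #(𝒞∩(𝒜∩ℬ)ᶜˢ) + 1_C(u)·#(𝒜∩ℬᶜˢ)`.
* **`zProfile_nonneg_of_mem`** (THEOREM, every `d`): `u ∈ C ⟹ zProfile A B C u ≥ 0` for up-sets `A, B, C` — by the Boolean face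
  `zProfile_face_nonneg` (Kleitman, then Harris; file `…ZProfile`).  Hence `sum_zProfile_nonneg_of_subset`: `Σ_{u∈U} zProfile ≥ 0`
  for every `U ⊆ C`.
* `@[conjecture] ZProfileDual d`: the z-profile lies in the dual cone of up-sets (`Σ_{u∈U} zProfile A B C u ≥ 0` for ALL up-sets
  `A,B,C,U`) — generation-8 "Conjecture G" (exhaustive `d ≤ 2`; sampled `d = 3, 4`: 0 violations; the x- and y-profiles are NOT in the dual
  cone).  `patternPos_of_zProfileDual`: it implies `PatternPos d` (`U = [3]^d`).  OPEN; an obligation, never a fact.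
Nothing here asserts `ZProfileDual d` or `PatternPos d` for `d ≥ 4`. [this work]
-/

namespace Summit.CriticalPhenomena.PercolationContinuityZ3.Theorems.SahiGridPattern

open Finset SahiGrid3
open scoped BigOperators FinsetFamily

variable {d : ℕ}

/-! ### Permutations of `Fin 3` from their values at `0` and `2` -/

/-- The function `Fin 3 → Fin 3` with values `(a, −(a+c), c)`. [this work] -/
def tri (a c : Fin 3) : Fin 3 → Fin 3 := ![a, -(a + c), c]

/-- For `a ≠ c` the function `tri a c` is injective. [this work] -/
theorem tri_injective : ∀ a c : Fin 3, a ≠ c → Function.Injective (tri a c) := by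
  unfold tri Function.Injective; decide

/-- The permutation of `Fin 3` with values `a` at `0` and `c` at `2` (for `a ≠ c`). [this work] -/
noncomputable def permOf (a c : Fin 3) (h : a ≠ c) : Equiv.Perm (Fin 3) :=
  Equiv.ofBijective (tri a c) (Finite.injective_iff_bijective.1 (tri_injective a c h))

/-- Value of `permOf` at `0`. [this work] -/
theorem permOf_zero (a c : Fin 3) (h : a ≠ c) : permOf a c h 0 = a := by
  simp [permOf, tri]

/-- Value of `permOf` at `2`. [this work] -/
theorem permOf_two (a c : Fin 3) (h : a ≠ c) : permOf a c h 2 = c := by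
  simp [permOf, tri]

/-- The middle value of a permutation of `Fin 3` is determined by the outer two. [this work] -/
theorem perm_one_eq : ∀ σ : Equiv.Perm (Fin 3), σ 1 = -(σ 0 + σ 2) := by decide

/-- The outer values of a permutation of `Fin 3` differ. [this work] -/
theorem perm_zero_ne_two : ∀ σ : Equiv.Perm (Fin 3), σ 0 ≠ σ 2 := by decide

/-- A permutation of `Fin 3` is recovered from its values at `0` and `2`. [this work] -/
theorem permOf_eq (σ : Equiv.Perm (Fin 3)) : permOf (σ 0) (σ 2) (perm_zero_ne_two σ) = σ := by
  ext i
  fin_cases i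
  · simp [permOf, tri]
  · simp [permOf, tri, perm_one_eq σ]
  · simp [permOf, tri]

/-! ### The z-profile and the z-decomposition of `sStarD` -/

/-- **The z-profile**: `zProfile A B C u = Σ_{x δ̸ u} h(x, thirdPt x u, u)` — the three-copy kernel summed over the permutation
patterns whose third point is `u`. [this work] -/
def zProfile (A B C : Finset (Pd d)) (u : Pd d) : ℤ :=
  ∑ x ∈ univ.filter (fun x : Pd d => TotDist x u = true), hZ A B C x (thirdPt x u) u

/-- Pattern-to-pair map: `π ↦ (P^π_2, P^π_0)`. [this work] -/
def pairOf (π : Fin d → Equiv.Perm (Fin 3)) : Pd d × Pd d := (col π 2, col π 0)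

/-- Pair-to-pattern map (junk outside `x δ̸ u`). [this work] -/
noncomputable def patOf (p : Pd d × Pd d) : Fin d → Equiv.Perm (Fin 3) :=
  fun a => if h : p.2 a ≠ p.1 a then permOf (p.2 a) (p.1 a) h else 1

/-- **z-decomposition**: `sStarD A B C = Σ_u zProfile A B C u`. [this work] -/
theorem sStarD_eq_sum_zProfile (A B C : Finset (Pd d)) : sStarD A B C = ∑ u, zProfile A B C u := by
  classical
  have hmid : ∀ (π : Fin d → Equiv.Perm (Fin 3)), col π 1 = thirdPt (col π 0) (col π 2) := by
    intro π; funext a; exact perm_one_eq (π a)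
  -- reindex the pattern sum by pairs (u, x) with x δ̸ u
  have h1 : sStarD A B C = ∑ p ∈ (univ : Finset (Pd d × Pd d)).filter (fun p => TotDist p.2 p.1 = true),
      hZ A B C p.2 (thirdPt p.2 p.1) p.1 := by
    unfold sStarD
    refine Finset.sum_nbij' pairOf patOf (fun π _ => ?_) (fun p _ => mem_univ _) (fun π _ => ?_) (fun p hp => ?_) (fun π _ => ?_)
    · rw [mem_filter]; refine ⟨mem_univ _, totDist_iff.2 fun a => ?_⟩
      exact perm_zero_ne_two (π a)
    · funext a
      unfold patOf pairOf col
      rw [dif_pos (perm_zero_ne_two (π a))]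
      exact permOf_eq (π a)
    · rw [mem_filter] at hp
      have ht := totDist_iff.1 hp.2
      unfold pairOf
      refine Prod.ext (funext fun a => ?_) (funext fun a => ?_)
      · show (patOf p a) 2 = p.1 a
        unfold patOf; rw [dif_pos (ht a)]; exact permOf_two _ _ _
      · show (patOf p a) 0 = p.2 a
        unfold patOf; rw [dif_pos (ht a)]; exact permOf_zero _ _ _
    · show hZ A B C (col π 0) (col π 1) (col π 2) = hZ A B C (col π 0) (thirdPt (col π 0) (col π 2)) (col π 2)
      rw [hmid]
  rw [h1, Finset.sum_filter, Fintype.sum_prod_type]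
  refine Finset.sum_congr rfl fun u _ => ?_
  unfold zProfile
  rw [Finset.sum_filter]

/-! ### The Boolean cube around `u` -/

/-- The larger of the two values of `Fin 3` other than `v`. [this work] -/
def hiVal (v : Fin 3) : Fin 3 := if v = 2 then 1 else 2

/-- The smaller of the two values of `Fin 3` other than `v`. [this work] -/
def loVal (v : Fin 3) : Fin 3 := if v = 0 then 1 else 0

/-- `hiVal v ≠ v`. [this work] -/
theorem hiVal_ne : ∀ v : Fin 3, hiVal v ≠ v := by decide
/-- `loVal v ≠ v`. [this work] -/
theorem loVal_ne : ∀ v : Fin 3, loVal v ≠ v := by decide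
/-- `loVal v ≠ hiVal v`. [this work] -/
theorem loVal_ne_hiVal : ∀ v : Fin 3, loVal v ≠ hiVal v := by decide
/-- `loVal v ≤ hiVal v`. [this work] -/
theorem loVal_le_hiVal : ∀ v : Fin 3, loVal v ≤ hiVal v := by decide
/-- A value other than `v` is `hiVal v` or `loVal v`. [this work] -/
theorem eq_hi_or_lo : ∀ v w : Fin 3, w ≠ v → (w = hiVal v ∨ w = loVal v) := by decide
/-- The third value after `hiVal v` and `v` is `loVal v`. [this work] -/
theorem neg_hi_add : ∀ v : Fin 3, -(hiVal v + v) = loVal v := by decide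
/-- The third value after `loVal v` and `v` is `hiVal v`. [this work] -/
theorem neg_lo_add : ∀ v : Fin 3, -(loVal v + v) = hiVal v := by decide
/-- Below `loVal v` (and `≠ v`) means equal to it. [this work] -/
theorem le_lo_imp : ∀ v w : Fin 3, w ≠ v → w ≤ loVal v → w = loVal v := by decide

/-- Chart of the Boolean cube around `u`: `T ↦` the point with the larger value on `T` and the smaller one off `T`. [this work] -/
def fromSet (u : Pd d) (T : Finset (Fin d)) : Pd d := fun a => if a ∈ T then hiVal (u a) else loVal (u a)

/-- Inverse chart. [this work] -/
def toSet (u x : Pd d) : Finset (Fin d) := univ.filter fun a => x a = hiVal (u a)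

/-- Chart points differ from `u` in every axis. [this work] -/
theorem fromSet_totDist (u : Pd d) (T : Finset (Fin d)) : TotDist (fromSet u T) u = true := by
  rw [totDist_iff]; intro a
  unfold fromSet; split_ifs
  · exact hiVal_ne _
  · exact loVal_ne _

/-- `toSet ∘ fromSet = id`. [this work] -/
theorem toSet_fromSet (u : Pd d) (T : Finset (Fin d)) : toSet u (fromSet u T) = T := by
  ext a
  unfold toSet fromSet
  rw [mem_filter]
  constructor
  · rintro ⟨_, h⟩
    by_contra hna
    rw [if_neg hna] at h
    exact loVal_ne_hiVal _ h
  · intro ha; exact ⟨mem_univ _, by rw [if_pos ha]⟩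

/-- `fromSet ∘ toSet = id` on the cube around `u`. [this work] -/
theorem fromSet_toSet {u x : Pd d} (hx : TotDist x u = true) : fromSet u (toSet u x) = x := by
  funext a
  have hm : a ∈ toSet u x ↔ x a = hiVal (u a) := by unfold toSet; rw [mem_filter]; simp
  unfold fromSet
  by_cases hh : x a = hiVal (u a)
  · rw [if_pos (hm.2 hh), hh]
  · rw [if_neg (fun h' => hh (hm.1 h'))]
    rcases eq_hi_or_lo (u a) (x a) ((totDist_iff.1 hx) a) with h | h
    · exact absurd h hh
    · rw [h]

/-- The complement of the chart is the third point. [this work] -/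
theorem thirdPt_fromSet (u : Pd d) (T : Finset (Fin d)) : thirdPt (fromSet u T) u = fromSet u Tᶜ := by
  funext a
  unfold thirdPt fromSet
  by_cases ha : a ∈ T
  · rw [if_pos ha, if_neg (by simpa using ha)]; exact neg_hi_add _
  · rw [if_neg ha, if_pos (by simpa using ha)]; exact neg_lo_add _

/-- The chart is monotone. [this work] -/
theorem fromSet_mono (u : Pd d) {T T' : Finset (Fin d)} (h : T ⊆ T') : fromSet u T ≤ fromSet u T' := by
  intro a
  unfold fromSet
  by_cases ha : a ∈ T
  · rw [if_pos ha, if_pos (h ha)]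
  · rw [if_neg ha]; split_ifs
    · exact loVal_le_hiVal _
    · exact le_rfl

/-- The trace of `A` on the Boolean cube around `u`, as a set family. [this work] -/
def fam (u : Pd d) (A : Finset (Pd d)) : Finset (Finset (Fin d)) := univ.filter fun T => fromSet u T ∈ A

/-- Membership in the trace family. [this work] -/
theorem mem_fam {u : Pd d} {A : Finset (Pd d)} {T : Finset (Fin d)} : T ∈ fam u A ↔ fromSet u T ∈ A := by
  unfold fam; rw [mem_filter]; simp

/-- Up-sets trace upper families. [this work] -/
theorem isUpperSet_fam (u : Pd d) {A : Finset (Pd d)} (hA : IsUpperSet (A : Set (Pd d))) :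
    IsUpperSet ((fam u A : Finset (Finset (Fin d))) : Set (Finset (Fin d))) := by
  intro T T' hTT' hT
  rw [Finset.mem_coe, mem_fam] at hT ⊢
  exact hA (fromSet_mono u hTT') hT

/-- The trace of an intersection. [this work] -/
theorem fam_inter (u : Pd d) (A B : Finset (Pd d)) : fam u (A ∩ B) = fam u A ∩ fam u B := by
  ext T; simp only [mem_inter, mem_fam]

/-! ### The z-profile through the chart -/

/-- Product of three indicators as one indicator. [this work] -/
theorem ind_mul3_ite {Y : Type*} [DecidableEq Y] (A B C : Finset Y) (x y z : Y) :
    ind A x * ind B y * ind C z = if (x ∈ A ∧ y ∈ B ∧ z ∈ C) then 1 else 0 := by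
  unfold ind; split_ifs <;> simp_all

/-- Sum over the cube around `u` as a sum over subsets of the axes. [this work] -/
theorem sum_totDist_eq_sum_sets (u : Pd d) (F : Pd d → ℤ) :
    (∑ x ∈ univ.filter (fun x : Pd d => TotDist x u = true), F x) = ∑ T : Finset (Fin d), F (fromSet u T) := by
  refine Finset.sum_nbij' (toSet u) (fromSet u) (fun x _ => mem_univ _) (fun T _ => ?_) (fun x hx => ?_) (fun T _ => toSet_fromSet u T)
    (fun x hx => ?_)
  · rw [mem_filter]; exact ⟨mem_univ _, fromSet_totDist u T⟩
  · rw [mem_filter] at hx; exact fromSet_toSet hx.2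
  · rw [mem_filter] at hx; rw [fromSet_toSet hx.2]

/-- Counting an indicator over the subsets of the axes. [this work] -/
theorem sum_ite_eq_card (P : Finset (Fin d) → Prop) [DecidablePred P] :
    (∑ T : Finset (Fin d), if P T then (1:ℤ) else 0) = ((univ.filter P).card : ℤ) := by
  rw [Finset.sum_boole]

/-- **The z-profile through the chart**: with `𝒜 = fam u A` etc.,
`zProfile A B C u = 2·#(𝒜∩ℬ∩𝒞) − #(𝒜∩(ℬ∩𝒞)ᶜˢ) − #(ℬ∩(𝒜∩𝒞)ᶜˢ) − #(𝒞∩(𝒜∩ℬ)ᶜˢ) + 1_C(u)·#(𝒜∩ℬᶜˢ)`. [this work] -/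
theorem zProfile_eq_card (A B C : Finset (Pd d)) (u : Pd d) :
    zProfile A B C u =
      2 * ((fam u A ∩ fam u B ∩ fam u C).card : ℤ) - ((fam u A ∩ (fam u B ∩ fam u C)ᶜˢ).card : ℤ)
        - ((fam u B ∩ (fam u A ∩ fam u C)ᶜˢ).card : ℤ) - ((fam u C ∩ (fam u A ∩ fam u B)ᶜˢ).card : ℤ)
        + ind C u * ((fam u A ∩ (fam u B)ᶜˢ).card : ℤ) := by
  unfold zProfile
  rw [sum_totDist_eq_sum_sets]
  simp only [hZ, thirdPt_fromSet]
  simp only [Finset.sum_add_distrib, Finset.sum_sub_distrib]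
  have e1 : (∑ T : Finset (Fin d), 2 * (ind A (fromSet u T) * ind B (fromSet u T) * ind C (fromSet u T))) =
      2 * ((fam u A ∩ fam u B ∩ fam u C).card : ℤ) := by
    rw [← Finset.mul_sum]
    simp only [ind_mul3_ite]
    rw [sum_ite_eq_card]
    congr 3; ext T; simp [mem_fam]
  have e2 : (∑ T : Finset (Fin d), ind A (fromSet u T) * ind B (fromSet u Tᶜ) * ind C (fromSet u Tᶜ)) =
      ((fam u A ∩ (fam u B ∩ fam u C)ᶜˢ).card : ℤ) := by
    simp only [ind_mul3_ite]; rw [sum_ite_eq_card]; congr 2; ext T; simp [mem_fam, mem_compls]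
  have e3 : (∑ T : Finset (Fin d), ind B (fromSet u T) * ind A (fromSet u Tᶜ) * ind C (fromSet u Tᶜ)) =
      ((fam u B ∩ (fam u A ∩ fam u C)ᶜˢ).card : ℤ) := by
    simp only [ind_mul3_ite]; rw [sum_ite_eq_card]; congr 2; ext T; simp [mem_fam, mem_compls]
  have e4 : (∑ T : Finset (Fin d), ind C (fromSet u T) * ind A (fromSet u Tᶜ) * ind B (fromSet u Tᶜ)) =
      ((fam u C ∩ (fam u A ∩ fam u B)ᶜˢ).card : ℤ) := by
    simp only [ind_mul3_ite]; rw [sum_ite_eq_card]; congr 2; ext T; simp [mem_fam, mem_compls]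
  have e5 : (∑ T : Finset (Fin d), ind A (fromSet u T) * ind B (fromSet u Tᶜ) * ind C u) =
      ind C u * ((fam u A ∩ (fam u B)ᶜˢ).card : ℤ) := by
    have : ∀ T : Finset (Fin d), ind A (fromSet u T) * ind B (fromSet u Tᶜ) * ind C u =
        ind C u * (if (fromSet u T ∈ A ∧ fromSet u Tᶜ ∈ B) then 1 else 0) := by
      intro T; unfold ind; split_ifs <;> simp_all
    simp only [this]
    rw [← Finset.mul_sum, sum_ite_eq_card]
    congr 3; ext T; simp [mem_fam, mem_compls]
  rw [e1, e2, e3, e4, e5]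

/-- **THE z-PROFILE IS NONNEGATIVE ON `C`** (every dimension): for up-sets `A, B, C` of `[3]^d` and `u ∈ C`,
`zProfile A B C u ≥ 0`.  Proof: chart to the Boolean cube around `u` and apply `zProfile_face_nonneg` (Kleitman, then Harris).
[this work] -/
theorem zProfile_nonneg_of_mem {A B C : Finset (Pd d)} (hA : IsUpperSet (A : Set (Pd d))) (hB : IsUpperSet (B : Set (Pd d)))
    (hC : IsUpperSet (C : Set (Pd d))) {u : Pd d} (hu : u ∈ C) : 0 ≤ zProfile A B C u := by
  rw [zProfile_eq_card]
  have key := zProfile_face_nonneg (isUpperSet_fam u hA) (isUpperSet_fam u hB) (isUpperSet_fam u hC)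
  have hind : ind C u = 1 := by unfold ind; rw [if_pos hu]
  rw [hind, one_mul]
  have k' : ((fam u A ∩ (fam u B ∩ fam u C)ᶜˢ).card : ℤ) + ((fam u B ∩ (fam u A ∩ fam u C)ᶜˢ).card : ℤ)
      + ((fam u C ∩ (fam u A ∩ fam u B)ᶜˢ).card : ℤ) ≤ 2 * ((fam u A ∩ fam u B ∩ fam u C).card : ℤ)
      + ((fam u A ∩ (fam u B)ᶜˢ).card : ℤ) := by exact_mod_cast key
  linarith

/-- `Σ_{u ∈ U} zProfile A B C u ≥ 0` for every `U ⊆ C`. [this work] -/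
theorem sum_zProfile_nonneg_of_subset {A B C U : Finset (Pd d)} (hA : IsUpperSet (A : Set (Pd d)))
    (hB : IsUpperSet (B : Set (Pd d))) (hC : IsUpperSet (C : Set (Pd d))) (hU : U ⊆ C) :
    0 ≤ ∑ u ∈ U, zProfile A B C u :=
  Finset.sum_nonneg fun _ hu => zProfile_nonneg_of_mem hA hB hC (hU hu)

/-! ### Conjecture G as an obligation -/

/-- **`ZProfileDual d`** ("Conjecture G", generation 8): for all up-sets `A, B, C, U` of `[3]^d`, `Σ_{u∈U} zProfile A B C u ≥ 0` — the
z-profile of the pattern functional lies in the dual cone of the up-sets.  `U = [3]^d` is `PatternPos d`; the faces `U ⊆ C` are the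
theorem `sum_zProfile_nonneg_of_subset`.  Evidence: exhaustive for `d ≤ 2`, sampled (several 10⁶ triples, exact dual-cone test) for
`d = 3, 4` without violation.  OPEN; an obligation / hypothesis, never a fact. [this work] [status: open] -/
@[conjecture] def ZProfileDual (d : ℕ) : Prop :=
  ∀ A B C U : Finset (Pd d), IsUpperSet (A : Set (Pd d)) → IsUpperSet (B : Set (Pd d)) → IsUpperSet (C : Set (Pd d)) →
    IsUpperSet (U : Set (Pd d)) → 0 ≤ ∑ u ∈ U, zProfile A B C u

/-- **Conjecture G implies the pattern inequality**: `ZProfileDual d → PatternPos d`. [this work] -/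
theorem patternPos_of_zProfileDual (h : ZProfileDual d) : PatternPos d := by
  intro A B C hA hB hC
  rw [sStarD_eq_sum_zProfile]
  exact h A B C univ hA hB hC (by rw [Finset.coe_univ]; exact isUpperSet_univ)

/-! ### A face in every dimension: `C = [3]^d` -/

/-- **`PatternPos` with `C` the whole cube, every dimension**: `sStarD A B univ ≥ 0` for up-sets `A, B` — every point of the
z-profile then lies in `C = [3]^d`, so the profile is pointwise nonnegative (`zProfile_nonneg_of_mem`).  (Classically this face is
the negative quadrant dependence of Latin hypercube pairs plus Harris; here it falls out of the z-decomposition.) [this work] -/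
theorem sStarD_univ_nonneg {A B : Finset (Pd d)} (hA : IsUpperSet (A : Set (Pd d))) (hB : IsUpperSet (B : Set (Pd d))) :
    0 ≤ sStarD A B univ := by
  rw [sStarD_eq_sum_zProfile]
  exact Finset.sum_nonneg fun u _ =>
    zProfile_nonneg_of_mem hA hB (by rw [Finset.coe_univ]; exact isUpperSet_univ) (mem_univ u)

end Summit.CriticalPhenomena.PercolationContinuityZ3.Theorems.SahiGridPattern
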